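import Summits.BirchSwinnertonDyer.Rank1Residual.X12.O11.RamifiedRelativeValuationLineZp
import Summits.BirchSwinnertonDyer.BirchSwinnertonDyer.Theorems.RamifiedSevenEllipticUnitsIntegralEvaluationTransfer
import HarnessLib

set_option linter.dupNamespace false
set_option autoImplicit false

/-!
# K7r crux `EllipticUnitValueSevenOfGZK` (stmt-BirchSwinnertonDyer-19945), line `rubin-formula-zp` v3 —
# S_relval (`X12.O11.RamifiedCMRelativeValuationAtZp W p D₀`) REDUCED IN THE KERNEL to FRAME VALUATION
# DATA: the same telescope with the conclusion `(l : ℤ) = padicValRat p r` replaced by ten elements of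
# `K_𝔭` and their valuation relations (cell `bsd-cm`, seat `bsd-cm-k7r-c3` g9; helper, `--supports` 19945;
# companion of `…IntegralEvaluationTransfer.lean` p491235 and `…PadicComplexTransfer.lean` p491487)

HONEST FRAMING. Nothing is asserted about the crux; no definition, no named fact, `sorry`-free; BSD is not
proved by any of this. S_relval (seat k7r-c4, p487655) is ram g9's RELATIVE RUBIN VALUATION THEOREM in
conclusion form; its inputs are [BKNO] Thm. 4.12 at the de Rham characters `ξ_{p^m}` for the member `W`
and the base `W₀` [(iii), PREPRINT], the `D`-independence of the `p`-adic period [(iv), a derivation],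
the unit base [(v)], the generator valuation `ord_𝔭(φ_ac(γ) − 1) = 1` [(F2)], Thm. 7.2 at `𝟙` [the reading
of `l`], and the ultrametric transfer [(vi), kernel]. The (T4) typing of [BKNO] Def. 4.7 / Thm. 4.12 /
Thm. 7.2 (tabled with bsd-littype-10) will deliver these as statements about ELEMENTS OF A VALUE FIELD.
THIS FILE shows, in the kernel, that S_relval then follows from NOTHING MORE than the following data in
`K_𝔭 = 𝔭.adicCompletion K` at each instance of its telescope — `a = 𝓛_W(ξ)`, `c = 𝓛_W(𝟙)`,
`x = ξ(γ) − 1`, `u = φ_ac(γ)`, `ℓ₀ = 𝓛_{W₀}(ξ)`, the periods `per`, `per₀`, the base value `A₀ ≠ 0`, the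
relative value `ρ` — subject to: `v (a − c) ≤ v x` [(vi): `𝓛_W ∈ 𝒪⟦X⟧` evaluated at `x`, e.g.
`Ultrametric.map_eval_sub_eval_C_le`], `v (u − 1) = exp(−1)` [(F2)], `x = u^{p^m} − 1`,
`a · per = A₀ · ρ` and `ℓ₀ · per₀ = A₀` [(iii) for `W` and `W₀`, the common constant `(−2πp/|d_K|)^{p^m}`
inside `A₀`], `v per = v per₀` [(iv)], `v ℓ₀ = 1` [(v)], `ρ² = r` [the v3 carrier identity read through
`ι.symm`, which fixes `ℚ`], `v c = exp(−l)` [Thm. 7.2 at `𝟙`]: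
* `Ultrametric.natCast_eq_padicValRat_of_map_sub_le_of_isFrame` — the ELEMENTS-ONLY endgame at the O11
  frame: these relations and `padicValRat p r < 1 + 2m` give `(l : ℤ) = padicValRat p r`.
* `RelativeValuationOfFrameData.ramifiedCMRelativeValuationAtZp_of_frameValuationData` — **S_relval from
  its own telescope ending in `∃ a c x u ℓ₀ per per₀ A₀ ρ, …` (the ten relations)**: the registered stub
  `stub_relativeValuationSevenZp` closes by this theorem the day the (T4) objects discharge the data
  hypothesis (the line owner's v4 split: S_412(W), S_412(W₀), S_per, S_unit, S_72, (F2) ⇒ data).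
The data hypothesis is an explicit `∀ … ∃ …` over S_relval's binders, not a new `def` (the line owner names
it if the v4 skeleton wants a registered stub of that shape).
References: [BKNO] arXiv:2608.06879 Def. 4.7, Thm. 4.12, Thm. 7.2 (shapes only)
[BurungaleKobayashiNakamuraOta2026]; J.-P. Serre, *Local Fields* (1979) Ch. II §1, XIV §4
[Serre1979]; memo RELATIVE-RUBIN-ram-g9.md §1 THEOREM (2); cell STATUS D123/D127/D128.
-/

noncomputable section

open scoped Classical

namespace Summit.BirchSwinnertonDyer.BirchSwinnertonDyer.Theorems.RamifiedSevenEllipticUnits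

open WeierstrassCurve NumberField IsDedekindDomain IsDedekindDomain.HeightOneSpectrum Field PowerSeries
  Literature.NumberTheory.EllipticCurves
  Literature.NumberTheory.EllipticCurves.Rank1Residual
  Literature.NumberTheory.EllipticCurves.BurungaleKobayashiNakamuraOta2026
  Literature.NumberTheory.EllipticCurves.Castella2018
  Literature.NumberTheory.GaloisRepresentations
  Literature.NumberTheory.DiophantineGeometry
  Summit.BirchSwinnertonDyer.Rank1Residual
  Summit.BirchSwinnertonDyer.Rank1Residual.Additive
  Summit.BirchSwinnertonDyer.Rank1Residual.X12
  Summit.BirchSwinnertonDyer.Rank1Residual.X12.O11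

namespace Ultrametric

variable {W : WeierstrassCurve ℚ} [W.IsElliptic] [W.IsGloballyMinimal] {p : ℕ} [hp : Fact p.Prime]
  {K : Type} [Field K] [NumberField K] {𝔭 : HeightOneSpectrum (𝓞 K)}
  {W' : WeierstrassCurve ℚ} {vc : VariableChange ℚ}

omit [W.IsGloballyMinimal] in
/-- **«`ord_π 𝓛_W(ξ) = ord_π ρ`» from elements** (memo §1 THEOREM (1)): `a · per = A₀ · ρ`, `ℓ₀ · per₀ = A₀`,
`v per = v per₀` [(iv)], `v ℓ₀ = 1` [(v)], `A₀ ≠ 0` ⇒ `Valued.v a = Valued.v ρ`.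
[cite: BurungaleKobayashiNakamuraOta2026, Thm. 4.12 (arXiv:2608.06879 p. 32) (claim; preprint; shape only)] -/
theorem valued_eq_of_interpolation {a ℓ₀ per per₀ A₀ ρ : 𝔭.adicCompletion K} (hD : a * per = A₀ * ρ)
    (hD₀ : ℓ₀ * per₀ = A₀) (hper : Valued.v per = Valued.v per₀) (hunit : Valued.v ℓ₀ = 1)
    (hA₀ : A₀ ≠ 0) : Valued.v a = Valued.v ρ := by
  have hA₀' : Valued.v A₀ ≠ 0 := (Valuation.ne_zero_iff _).2 hA₀
  have h := map_mul_eq_of_interpolation Valued.v hD hD₀ hper hunit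
  rw [map_mul, mul_comm (Valued.v A₀)] at h
  exact mul_right_cancel₀ hA₀' h

omit [W.IsGloballyMinimal] in
/-- **THE ELEMENTS-ONLY ENDGAME AT THE O11 FRAME.** For elements `a = 𝓛_W(ξ)`, `c = 𝓛_W(𝟙)`,
`x = ξ(γ) − 1 = u^{p^m} − 1` of `K_𝔭` with `v (a − c) ≤ v x` [(vi), integrality of `𝓛_W`],
`v (u − 1) = exp(−1)` [(F2)], the interpolation identities `a · per = A₀ · ρ`, `ℓ₀ · per₀ = A₀` [(iii)],
`v per = v per₀` [(iv)], `v ℓ₀ = 1` [(v)], `A₀ ≠ 0`, `ρ² = r ∈ ℚ^×`, the threshold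
`padicValRat p r < 1 + 2m`, and the bottom reading `v c = exp(−l)` [Thm. 7.2 at `𝟙`]:
`(l : ℤ) = padicValRat p r`. [cite: BurungaleKobayashiNakamuraOta2026, Thm. 4.12, Def. 4.7 and Thm. 7.2 (arXiv:2608.06879 pp. 27, 32, 41) (claim; preprint; shape only)] -/
theorem natCast_eq_padicValRat_of_map_sub_le_of_isFrame (hF : IsFrame W p K 𝔭 W' vc)
    {a c x u ℓ₀ per per₀ A₀ ρ : 𝔭.adicCompletion K} {m l : ℕ} {r : ℚ}
    (hsub : Valued.v (a - c) ≤ Valued.v x) (hu : Valued.v (u - 1) = WithZero.exp (-1))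
    (hx : x = u ^ (p ^ m) - 1) (hD : a * per = A₀ * ρ) (hD₀ : ℓ₀ * per₀ = A₀)
    (hper : Valued.v per = Valued.v per₀) (hunit : Valued.v ℓ₀ = 1) (hA₀ : A₀ ≠ 0) (hr : r ≠ 0)
    (hρ : ρ ^ 2 = ((r : K) : 𝔭.adicCompletion K)) (hlt : padicValRat p r < 1 + 2 * (m : ℤ))
    (hbottom : Valued.v c = WithZero.exp (-(l : ℤ))) : (l : ℤ) = padicValRat p r := by
  have hvx : Valued.v x = WithZero.exp (-(1 + 2 * (m : ℤ))) := by
    rw [hx, ← valued_one_add_pow_prime_pow_sub_one_of_isFrame hF hu m, add_sub_cancel]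
  have hvρ : Valued.v ρ = WithZero.exp (-padicValRat p r) :=
    valued_eq_of_sq_eq_ratCast_of_isFrame hF hr hρ
  have hva : Valued.v a = Valued.v ρ := valued_eq_of_interpolation hD hD₀ hper hunit hA₀
  have hlt' : Valued.v x < Valued.v a := by
    rw [hva, hvx, hvρ, WithZero.exp_lt_exp]
    linarith
  have h := map_const_eq_of_map_sub_le_of_lt Valued.v hsub hlt'
  rw [hbottom, hva, hvρ, WithZero.exp_inj] at h
  linarith

end Ultrametric

namespace RelativeValuationOfFrameData

variable {W : WeierstrassCurve ℚ} [W.IsElliptic] [W.IsGloballyMinimal] {p : ℕ} [Fact p.Prime] {D₀ : ℤ}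

omit [W.IsGloballyMinimal] in
/-- **S_relval FROM FRAME VALUATION DATA (kernel reduction of the registered stub's target).** If at
every instance of S_relval's telescope — O11 frame `(K, 𝔭, W', C)`, analytic rank one, anticyclotomic
`κ` with generator `γ`, Mordell–Weil data, `#Ш_an`'s, pinned datum `(ι, φ, Ω, 𝓔, D, c)` with the
main-conjecture identity, local bottom exponent `l`, base model `W₀` of `49a1^{(D₀)}` with pinned `φ₀`,
exponent `m`, rational `r ≠ 0` with the two continuations and
`(heckePowerCentralValue φ (p^m) / heckePowerCentralValue φ₀ (p^m))² = r`, `padicValRat p r < 1 + 2m` —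
THERE ARE elements `a c x u ℓ₀ per per₀ A₀ ρ` of `K_𝔭` with `v (a − c) ≤ v x` [(vi)],
`v (u − 1) = exp(−1)` [(F2)], `x = u^{p^m} − 1`, `a · per = A₀ · ρ`, `ℓ₀ · per₀ = A₀` [(iii) = Thm. 4.12
for `W` and `W₀`], `v per = v per₀` [(iv)], `v ℓ₀ = 1` [(v)], `A₀ ≠ 0`, `ρ² = r` and `v c = exp(−l)`
[Thm. 7.2 at `𝟙`], THEN `RamifiedCMRelativeValuationAtZp W p D₀`. Proof: the elements-only endgame
`Ultrametric.natCast_eq_padicValRat_of_map_sub_le_of_isFrame`. The (T4) typing supplies the data; the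
line owner's v4 split of S_relval is this hypothesis cut into its named sources.
[cite: BurungaleKobayashiNakamuraOta2026, Thm. 4.12, Def. 4.7 and Thm. 7.2 (arXiv:2608.06879 pp. 27, 32, 41) (claim; preprint; shape only)] -/
theorem ramifiedCMRelativeValuationAtZp_of_frameValuationData
    (h : ∀ (K : Type) [Field K] [NumberField K] (𝔭 : HeightOneSpectrum (𝓞 K))
      (W' : WeierstrassCurve ℚ) [W'.IsElliptic] [W'.IsGloballyMinimal] (C : VariableChange ℚ),
      IsFrame W p K 𝔭 W' C → W.analyticRank = 1 →
      ∀ (κ : ZpExtension K p), κ.IsAnticyclotomic →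
        ∀ (γ : absoluteGaloisGroup K) [Fact (κ.IsTopGenerator γ)]
          (P : W.toAffine.Point) (n : ℕ) (P' : W'.toAffine.Point) (n' : ℕ),
          ¬ IsOfFinAddOrder P →
          (∀ R : W.toAffine.Point, ∃ (k : ℤ) (T : W.toAffine.Point), IsOfFinAddOrder T ∧ R = k • P + T) →
          (∀ Q : (W.baseChange ℚ_[p]).toAffine.Point, p • Q = 0 → Q = 0) →
          (∃ Q : (W.baseChange ℚ_[p]).toAffine.Point, p ^ n • Q = W.toPadicPoint p P) →
          (∀ Q : (W.baseChange ℚ_[p]).toAffine.Point, p ^ (n + 1) • Q ≠ W.toPadicPoint p P) →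
          ¬ IsOfFinAddOrder P' →
          (∀ R : W'.toAffine.Point, ∃ (k : ℤ) (T : W'.toAffine.Point),
            IsOfFinAddOrder T ∧ R = k • P' + T) →
          (∀ Q : (W'.baseChange ℚ_[p]).toAffine.Point, p • Q = 0 → Q = 0) →
          (∃ Q : (W'.baseChange ℚ_[p]).toAffine.Point, p ^ n' • Q = W'.toPadicPoint p P') →
          (∀ Q : (W'.baseChange ℚ_[p]).toAffine.Point, p ^ (n' + 1) • Q ≠ W'.toPadicPoint p P') →
          ∀ (q q' : ℚ), shaAn W = (q : ℂ) → shaAn W' = (q' : ℂ) →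
          ∀ (ι : PadicAlgCl p ≃+* ℂ) (φ : HeckeCharacter K) (Ω : ℂ) (𝓔 : AcDualExpSystem W p K 𝔭 κ ι)
            (D : EllipticUnitClassData W p K 𝔭 κ γ ι φ Ω 𝓔) (c : ℕ),
            Ω ≠ 0 → (∀ s : ℂ, 3 / 2 < s.re → heckeLFunction φ s = W.LSeries s) →
            D.HasBottomIndexExpZp c →
            (∀ (n₀ : ℕ), AcSelmer.XAc.HasCharValuationAt (W.baseChange K) p κ 𝔭 ∅ γ n₀ →
              Finite {x : AcSelmer.XAc (W.baseChange K) p κ 𝔭 ∅ γ //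
                (PowerSeries.X : IwasawaAlgebra p) • x = 0} →
              (n₀ : ℤ) + padicValNat p (Nat.card {x : AcSelmer.XAc (W.baseChange K) p κ 𝔭 ∅ γ //
                  (PowerSeries.X : IwasawaAlgebra p) • x = 0}) = c) →
            ∀ (l : ℕ), D.HasLocalBottomIndexExpZp l →
              ∀ (W₀ : WeierstrassCurve ℚ) [W₀.IsElliptic] [W₀.IsGloballyMinimal],
                (∃ C₀ : VariableChange ℚ, C₀ • W₀ = cm7.quadraticTwist (D₀ : ℚ)) →
                ∀ (φ₀ : HeckeCharacter K),
                  (∀ s : ℂ, 3 / 2 < s.re → heckeLFunction φ₀ s = W₀.LSeries s) →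
                  ∀ (m : ℕ) (r : ℚ),
                    LFunction.HasEntireContinuationFrom (((p ^ m : ℕ) : ℝ) + 3 / 2)
                        (heckeLFunction (φ ^ (2 * p ^ m + 1))) →
                      LFunction.HasEntireContinuationFrom (((p ^ m : ℕ) : ℝ) + 3 / 2)
                        (heckeLFunction (φ₀ ^ (2 * p ^ m + 1))) →
                    (heckePowerCentralValue φ (p ^ m) / heckePowerCentralValue φ₀ (p ^ m)) ^ 2 = (r : ℂ) →
                    r ≠ 0 → padicValRat p r < 1 + 2 * (m : ℤ) →
                    ∃ (a c' x u ℓ₀ per per₀ A₀ ρ : 𝔭.adicCompletion K),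
                      Valued.v (a - c') ≤ Valued.v x ∧ Valued.v (u - 1) = WithZero.exp (-1) ∧
                      x = u ^ (p ^ m) - 1 ∧ a * per = A₀ * ρ ∧ ℓ₀ * per₀ = A₀ ∧
                      Valued.v per = Valued.v per₀ ∧ Valued.v ℓ₀ = 1 ∧ A₀ ≠ 0 ∧
                      ρ ^ 2 = ((r : K) : 𝔭.adicCompletion K) ∧
                      Valued.v c' = WithZero.exp (-(l : ℤ))) :
    RamifiedCMRelativeValuationAtZp W p D₀ := by
  intro K _ _ 𝔭 W' _ _ C hF hr κ hκ γ _ P n P' n' hP hgen htors hdiv hndiv hP' hgen' htors' hdiv' hndiv'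
    q q' hq hq' ι φ Ω 𝓔 D c hΩ hφ hc himc l hl W₀ _ _ hW₀ φ₀ hφ₀ m r hcont hcont₀ hρ hr0 hlt
  obtain ⟨a, c', x, u, ℓ₀, per, per₀, A₀, ρ', hsub, hu, hx, hD, hD₀, hper, hunit, hA₀, hρ', hbottom⟩ :=
    h K 𝔭 W' C hF hr κ hκ γ P n P' n' hP hgen htors hdiv hndiv hP' hgen' htors' hdiv' hndiv' q q' hq hq'
      ι φ Ω 𝓔 D c hΩ hφ hc himc l hl W₀ hW₀ φ₀ hφ₀ m r hcont hcont₀ hρ hr0 hlt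
  exact Ultrametric.natCast_eq_padicValRat_of_map_sub_le_of_isFrame hF hsub hu hx hD hD₀ hper hunit hA₀
    hr0 hρ' hlt hbottom

end RelativeValuationOfFrameData

end Summit.BirchSwinnertonDyer.BirchSwinnertonDyer.Theorems.RamifiedSevenEllipticUnits

end
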